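import Literature.AnabelianGeometry.EtaleTheta.Discharge.Sec1OncePuncturedDtpYThetaAbelian
import Literature.AnabelianGeometry.EtaleTheta.Discharge.Sec1DtpYEllZHat
import HarnessLib

/-!
# [EtTh] §1 pp. 12–13 / [IUTchII] Rmk. 1.1.1 (iii): the commutator pairing `n ↦ [ι σ, n]` on the closure
# `N = (ι Δ^tp_Y)⁻` at the L3 interface `OncePuncturedTemperedGroup` — NON-DEGENERATE modulo `[Δ_X,Δ_X]⁻`
# and ONTO `[Δ_X,Δ_X]⁻/[Δ_X,[Δ_X,Δ_X]]⁻` (proof-only; step 2 of the FACT-LIST reduction F-0658 ⟸ F-1697)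

Mochizuki, *The étale theta function and its Frobenioid-theoretic manifestations*, Publ. RIMS **45** (2009)
[EtTh], §1, PRIMS PDF pp. 12–13 (printed 238–239): "Since `Δ_X` is a profinite free group on 2 generators,
we also have a natural exact sequence `1 → ∧² Δ^ell_X (≅ Ẑ(1)) → Δ^Θ_X → Δ^ell_X → 1` … Let us denote the
image of `∧² Δ^ell_X` in `Δ^Θ_X` by `(Ẑ(1) ≅) Δ_Θ ⊆ Δ^Θ_X` … `(Δ^tp_Y)^ell ≅ Ẑ(1)`" [cite: MochizukiEtTh2009, §1 p.12];
the pairing is [IUTchII] Rmk. 1.1.1 (iii) "`[-,-] : (Δ_X/Δ_Y) × Δ^ell_Y → Δ_Θ`".  abc-iut cell, block C / F =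
FACT-PROVING WAVE, seat abc-iut-f-172 (gen 2), tranche 172 (F-0658 · F-0659 · F-1697); PROOF-ONLY (no `def`,
no `instance`, no named fact).  A read-only consumer of abc-iut-L3's frozen interface (`OncePuncturedTemperedGroup`,
`deltaHat`, `ellKerHat`, `doubleCommutator`, `deltaY`, …), nothing of it edited or restated; the L3-interface
twin of abc-iut-w5-d006's `Sec1DtpYEllClosureZHat.lean` (there for the `p`-adic `ThetaSetting p`), re-using the
generic engines of abc-iut-L5-t14 (`ClassTwo.exists_commutator_mul_of_mem_closure`) and abc-iut-w5-d006
(`DtpYEllAux.exists_classTwo_center_test`, `DtpYEllAux.mem_of_forall_pairCharacter`) verbatim.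

WHAT IS PROVED, for EVERY `D : OncePuncturedTemperedGroup K` over a field `K : Type` (universe `0`: the
generic Heisenberg test groups of `DtpYEllAux` live in `Type`), with `ι = D.toHat`, `Δ_X = D.deltaHat`,
`K₂ = D.ellKerHat`, `K₃ = D.doubleCommutator`, `N = (ι Δ^tp_Y)⁻`, and `σ ∈ Δ^tp_X` with `zQuot σ = 1`:
* `OncePuncturedCyclotomic.mem_ellKerHat_of_commutator_mem_doubleCommutator` — **NON-DEGENERACY**: for
  `n ∈ N`, `[ι σ, n] ∈ K₃ ⇒ n ∈ K₂` (`n` is then central in `Δ_X` modulo `K₃` — it commutes with `ι σ` by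
  hypothesis and with `ι Δ^tp_Y` because `[ι Δ^tp_Y, N] ≤ K₃` (step 1, `Sec1OncePuncturedDtpYThetaAbelian.lean`),
  hence with the dense `ι Δ^tp_X ⊆ (ι σ)^ℤ · ι Δ^tp_Y`; testing on the finite Heisenberg quotients
  `Δ_X → H(ℤ/m)`, `a ↦ x`, `b ↦ y` of the free pair shows that `n` dies under every pair-character
  `Δ_X → (ℤ/m)²`, so `n ∈ K₂`);
* `OncePuncturedCyclotomic.exists_commutator_mul_of_mem_ellKerHat` — **HEISENBERG SURJECTIVITY**: every
  `k ∈ K₂` is `[ι σ, n] · k₃` with `n ∈ N`, `k₃ ∈ K₃` (generic, from `[N, N] ≤ K₃` of step 1 and the density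
  of `ι Δ^tp_X ⊆ (ι σ)^ℤ · N` in `Δ_X`; no freeness needed);
* `OncePuncturedCyclotomic.ellKerHat_le_closureDeltaY` — `K₂ ≤ N` (`[Δ_X,Δ_X] ≤ (ι[Δ^tp_X,Δ^tp_X])⁻` and
  `[Δ^tp_X,Δ^tp_X] ≤ Δ^tp_Y`, `Z` being abelian).

HONEST FRAMING: [EtTh] is refereed; the L3 interface is DATA quoting print, asserted for no curve; group
structure only (no Tate twist here); nothing here bears on [IUTchIII] Cor. 3.12; typed ≠ proved; no side is
taken on any disputed claim.
-/

noncomputable section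

namespace Literature.AnabelianGeometry.EtaleTheta

open Literature.AnabelianGeometry.SemiGraphs
open _root_.Topology
open scoped commutatorElement
open ClassTwo DtpYAbelian DtpYEllAux

namespace OncePuncturedCyclotomic

variable {K : Type} [Field K] (D : OncePuncturedTemperedGroup K)

/-- `K₃ = [Δ_X,[Δ_X,Δ_X]]⁻ = [[Δ_X,Δ_X],Δ_X]⁻` (the two printed bracketings agree). [cite: MochizukiEtTh2009, §1 p.12] -/
theorem doubleCommutator_eq_closure_commutator_commutator :
    D.doubleCommutator = (⁅⁅D.deltaHat, D.deltaHat⁆, D.deltaHat⁆).topologicalClosure := by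
  change (⁅D.deltaHat, ⁅D.deltaHat, D.deltaHat⁆⁆).topologicalClosure = _
  rw [Subgroup.commutator_comm D.deltaHat ⁅D.deltaHat, D.deltaHat⁆]

/-- **Non-degeneracy of the commutator pairing on `N = (ι Δ^tp_Y)⁻`** ([EtTh] pp. 12–13; [IUTchII]
Rmk. 1.1.1 (iii)), at the L3 interface: for `σ ∈ Δ^tp_X` mapping to the generator `1` of `Z` and `n` in the
closure of `ι Δ^tp_Y` in `Π_X`, if `[ι σ, n] ∈ [Δ_X,[Δ_X,Δ_X]]⁻` then `n ∈ [Δ_X,Δ_X]⁻`.  L3 twin of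
abc-iut-w5-d006's `ThetaSetting.IsEtThOrigin.mem_commutatorClosure_of_mem_closure_of_commutator_mem` (same
proof, the freeness guard being the interface field `deltaHat_free`). [cite: MochizukiEtTh2009, §1 p.13] -/
theorem mem_ellKerHat_of_commutator_mem_doubleCommutator
    {σ : D.Pi} (hσ : σ ∈ D.delta) (hσZ : D.zQuot σ = Multiplicative.ofAdd 1)
    {n : D.PiHat} (hn : n ∈ (D.deltaY.map D.toHat.toMonoidHom).topologicalClosure)
    (h : ⁅D.toHat.toMonoidHom σ, n⁆ ∈ D.doubleCommutator) : n ∈ D.ellKerHat := by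
  classical
  haveI : CompactSpace D.PiHat := D.isProfiniteCompletion_toHat.compactSpace
  haveI : T2Space D.PiHat := D.isProfiniteCompletion_toHat.t2Space
  haveI : TotallyDisconnectedSpace D.PiHat := D.isProfiniteCompletion_toHat.totallyDisconnectedSpace
  set K₂ : Subgroup D.PiHat := D.ellKerHat with hK₂def
  set K₃ : Subgroup D.PiHat := (⁅⁅D.deltaHat, D.deltaHat⁆, D.deltaHat⁆).topologicalClosure with hK₃def
  have hK₃eq : D.doubleCommutator = K₃ := doubleCommutator_eq_closure_commutator_commutator D
  rw [hK₃eq] at h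
  have hK₂closed : IsClosed (K₂ : Set D.PiHat) := Subgroup.isClosed_topologicalClosure _
  have hΔclosed : IsClosed (D.deltaHat : Set D.PiHat) := D.isClosed_deltaHat
  have hK₃closed : IsClosed (K₃ : Set D.PiHat) := Subgroup.isClosed_topologicalClosure _
  -- `N = (ι Δ^tp_Y)⁻ ≤ Δ_X`, and `[ι Δ^tp_Y, N] ≤ K₃` (`(Δ^tp_Y)^Θ` is abelian: step 1)
  have hNΔ : (D.deltaY.map D.toHat.toMonoidHom).topologicalClosure ≤ D.deltaHat :=
    closureDeltaY_le_deltaHat D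
  have hYN : ⁅D.deltaY.map D.toHat.toMonoidHom, (D.deltaY.map D.toHat.toMonoidHom).topologicalClosure⁆ ≤ K₃ := by
    rw [← hK₃eq]; exact commutator_map_deltaY_closure_le D
  -- the free pair of `Δ_X`
  haveI : CompactSpace ↥D.deltaHat := isCompact_iff_compactSpace.mp hΔclosed.isCompact
  obtain ⟨a, b, huniv, -⟩ := exists_generators D
  -- the element `g = n ∈ Δ_X` and `τ = ι σ ∈ Δ_X`
  set g : ↥D.deltaHat := ⟨n, hNΔ hn⟩ with hgdef
  set τ : ↥D.deltaHat := ⟨D.toHat.toMonoidHom σ, toHat_mem_deltaHat D hσ⟩ with hτdef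
  -- `K₂ ∩ Δ_X` as a closed normal subgroup of `Δ_X` containing the commutators
  haveI : (K₂.subgroupOf D.deltaHat).Normal := inferInstance
  have hKc : IsClosed ((K₂.subgroupOf D.deltaHat : Subgroup ↥D.deltaHat) : Set ↥D.deltaHat) :=
    hK₂closed.preimage continuous_subtype_val
  have hKcomm : ⁅(⊤ : Subgroup ↥D.deltaHat), (⊤ : Subgroup ↥D.deltaHat)⁆ ≤ K₂.subgroupOf D.deltaHat := by
    refine Subgroup.commutator_le.mpr fun u _ v _ => ?_
    rw [Subgroup.mem_subgroupOf]
    have hc : ((⁅u, v⁆ : ↥D.deltaHat) : D.PiHat) = ⁅(u : D.PiHat), (v : D.PiHat)⁆ := by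
      simp only [commutatorElement_def, Subgroup.coe_mul, Subgroup.coe_inv]
    rw [hc]
    exact Subgroup.le_topologicalClosure _ (Subgroup.commutator_mem_commutator u.2 v.2)
  -- it suffices to kill `g` under every pair-character `Δ_X → (ℤ/m)²`
  suffices hmem : g ∈ K₂.subgroupOf D.deltaHat by
    rw [Subgroup.mem_subgroupOf] at hmem
    exact hmem
  refine mem_of_forall_pairCharacter hKc hKcomm huniv fun m _ F hFa hFb => ?_
  -- the Heisenberg test group of level `m` and `F^H : Δ_X → H`, `a ↦ x`, `b ↦ y`
  obtain ⟨H, hHgrp, hHfin, x₀, y₀, pr, hprx, hpry, hQ3, hcenter⟩ := exists_classTwo_center_test m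
  letI : Group H := hHgrp
  haveI : Finite H := hHfin
  letI : TopologicalSpace H := ⊥
  haveI : DiscreteTopology H := ⟨rfl⟩
  obtain ⟨FH, ⟨hFHa, hFHb⟩, -⟩ := huniv H x₀ y₀
  have hFHc : Continuous FH.toMonoidHom := FH.continuous_toFun
  -- `pr ∘ F^H = F` (uniqueness of the freeness against `(ℤ/m)²`)
  have hprF : ∀ t : ↥D.deltaHat, pr (FH t) = F t := by
    obtain ⟨F₀, -, huniq⟩ := huniv (Multiplicative (ZMod m × ZMod m))
      (Multiplicative.ofAdd ((1 : ZMod m), (0 : ZMod m))) (Multiplicative.ofAdd ((0 : ZMod m), (1 : ZMod m)))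
    have hprc : Continuous pr := continuous_of_discreteTopology
    let P : ↥D.deltaHat →ₜ* Multiplicative (ZMod m × ZMod m) :=
      { toMonoidHom := pr.comp FH.toMonoidHom
        continuous_toFun := hprc.comp FH.continuous_toFun }
    have hP : P = F₀ := by
      refine huniq P ⟨?_, ?_⟩
      · change pr (FH a) = _
        rw [hFHa, hprx]
      · change pr (FH b) = _
        rw [hFHb, hpry]
    have hF : F = F₀ := huniq F ⟨hFa, hFb⟩
    intro t
    change P t = F t
    rw [hP, hF]
  -- `F^H` kills `K₂`'s commutators with `Δ_X`, i.e. `K₃`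
  have hF2 : ∀ t : ↥D.deltaHat, (t : D.PiHat) ∈ K₂ →
      FH.toMonoidHom t ∈ (⁅(⊤ : Subgroup H), (⊤ : Subgroup H)⁆ : Subgroup H) := by
    have h2 : K₂ ≤ ((⁅(⊤ : Subgroup H), (⊤ : Subgroup H)⁆ : Subgroup H).comap FH.toMonoidHom).map
        D.deltaHat.subtype := by
      refine Subgroup.topologicalClosure_minimal _ (Subgroup.commutator_le.mpr ?_)
        (isClosed_map_subtype_comap hΔclosed FH.toMonoidHom hFHc _)
      intro g₁ hg₁ g₂ hg₂
      refine ⟨⁅(⟨g₁, hg₁⟩ : ↥D.deltaHat), ⟨g₂, hg₂⟩⁆, ?_, rfl⟩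
      rw [SetLike.mem_coe, Subgroup.mem_comap, map_commutatorElement]
      exact Subgroup.commutator_mem_commutator (Subgroup.mem_top (FH.toMonoidHom ⟨g₁, hg₁⟩))
        (Subgroup.mem_top (FH.toMonoidHom ⟨g₂, hg₂⟩))
    exact fun t ht => mem_of_coe_mem_map_subtype_comap FH.toMonoidHom _ (h2 ht)
  have hF3 : ∀ t : ↥D.deltaHat, (t : D.PiHat) ∈ K₃ → FH.toMonoidHom t = 1 := by
    have h3 : K₃ ≤ ((⁅⁅(⊤ : Subgroup H), (⊤ : Subgroup H)⁆, (⊤ : Subgroup H)⁆ : Subgroup H).comap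
        FH.toMonoidHom).map D.deltaHat.subtype := by
      refine Subgroup.topologicalClosure_minimal _ (Subgroup.commutator_le.mpr ?_)
        (isClosed_map_subtype_comap hΔclosed FH.toMonoidHom hFHc _)
      intro c₀ hc₀ g' hg'
      have hc₀' : c₀ ∈ D.deltaHat := D.ellKerHat_le_deltaHat (Subgroup.le_topologicalClosure _ hc₀)
      refine ⟨⁅(⟨c₀, hc₀'⟩ : ↥D.deltaHat), ⟨g', hg'⟩⁆, ?_, rfl⟩
      rw [SetLike.mem_coe, Subgroup.mem_comap, map_commutatorElement]
      exact Subgroup.commutator_mem_commutator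
        (hF2 ⟨c₀, hc₀'⟩ (Subgroup.le_topologicalClosure _ hc₀)) (Subgroup.mem_top (FH.toMonoidHom ⟨g', hg'⟩))
    intro t ht
    exact hQ3 _ (mem_of_coe_mem_map_subtype_comap FH.toMonoidHom _ (h3 ht))
  -- the elements of `Δ_X` whose `F^H`-image commutes with `F^H g` form a closed subgroup `C` of `Π_X` …
  let C : Subgroup D.PiHat :=
    ((Subgroup.centralizer ({FH.toMonoidHom g} : Set H)).comap FH.toMonoidHom).map D.deltaHat.subtype
  have hCclosed : IsClosed (C : Set D.PiHat) :=
    isClosed_map_subtype_comap hΔclosed FH.toMonoidHom hFHc _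
  have hC_of : ∀ t : ↥D.deltaHat, FH.toMonoidHom (t * g * t⁻¹ * g⁻¹) = 1 → (t : D.PiHat) ∈ C := by
    intro t ht
    refine ⟨t, ?_, rfl⟩
    rw [SetLike.mem_coe, Subgroup.mem_comap, Subgroup.mem_centralizer_iff]
    intro h' hh'
    rw [Set.mem_singleton_iff] at hh'
    subst hh'
    rw [map_mul, map_mul, map_mul, map_inv, map_inv, ← commutatorElement_def,
      commutatorElement_eq_one_iff_mul_comm] at ht
    exact ht.symm
  -- … containing `τ = ι σ` (the hypothesis `[ι σ, n] ∈ K₃`) …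
  have hτC : (τ : D.PiHat) ∈ C := by
    refine hC_of τ (hF3 _ ?_)
    simp only [Subgroup.coe_mul, Subgroup.coe_inv, hτdef, hgdef]
    rw [← commutatorElement_def]
    exact h
  -- … and `ι Δ^tp_Y` (`(Δ^tp_Y)^Θ` is abelian: step 1) …
  have hYC : ∀ y' ∈ D.deltaY, D.toHat.toMonoidHom y' ∈ C := by
    intro y' hy'
    have hy'Δ : y' ∈ D.delta := (inf_le_left : D.deltaY ≤ D.delta) hy'
    refine hC_of ⟨D.toHat.toMonoidHom y', toHat_mem_deltaHat D hy'Δ⟩ (hF3 _ ?_)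
    simp only [Subgroup.coe_mul, Subgroup.coe_inv, hgdef]
    rw [← commutatorElement_def]
    exact hYN (Subgroup.commutator_mem_commutator (Subgroup.mem_map_of_mem _ hy') hn)
  -- … hence `ι Δ^tp_X ⊆ (ι σ)^ℤ · ι Δ^tp_Y` and, `C` being closed, all of `Δ_X`
  have hΔC : D.deltaHat ≤ C := by
    change (D.delta.map D.toHat.toMonoidHom).topologicalClosure ≤ C
    refine Subgroup.topologicalClosure_minimal _ ?_ hCclosed
    rintro _ ⟨t, ht, rfl⟩
    obtain ⟨i, u, hu, rfl⟩ := exists_eq_zpow_mul_of_mem_delta D hσ hσZ ht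
    rw [map_mul, map_zpow]
    exact C.mul_mem (C.zpow_mem hτC i) (hYC u hu)
  have hcomm_of_C : ∀ t : ↥D.deltaHat, (t : D.PiHat) ∈ C → Commute (FH.toMonoidHom g) (FH.toMonoidHom t) := by
    intro t ht
    have hmem := mem_of_coe_mem_map_subtype_comap FH.toMonoidHom _ ht
    rw [Subgroup.mem_centralizer_iff] at hmem
    exact (hmem _ (Set.mem_singleton _))
  have hx : Commute (FH g) x₀ := by
    rw [← hFHa]
    exact hcomm_of_C a (hΔC a.2)
  have hy₀ : Commute (FH g) y₀ := by
    rw [← hFHb]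
    exact hcomm_of_C b (hΔC b.2)
  rw [← hprF g]
  exact hcenter (FH g) hx hy₀

/-- **Heisenberg surjectivity at the L3 interface** ([EtTh] p. 12 "the image of `∧² Δ^ell_X` in `Δ^Θ_X`
[is] `Δ_Θ`"; p. 45 "the well-known structure of the theta-group"): for `σ ∈ Δ^tp_X` with `zQuot σ = 1`,
every element of `K₂ = [Δ_X,Δ_X]⁻` is `[ι σ, n] · k₃` with `n ∈ N = (ι Δ^tp_Y)⁻` and `k₃ ∈ K₃ = [Δ_X,[Δ_X,Δ_X]]⁻`
— abc-iut-L5-t14's generic `ClassTwo.exists_commutator_mul_of_mem_closure` with `[N, N] ≤ K₃` (step 1) and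
`ι Δ^tp_X ⊆ (ι σ)^ℤ · N` dense in `Δ_X`; no freeness is used. [cite: MochizukiEtTh2009, §1 p.12] -/
theorem exists_commutator_mul_of_mem_ellKerHat
    {σ : D.Pi} (hσ : σ ∈ D.delta) (hσZ : D.zQuot σ = Multiplicative.ofAdd 1)
    {k : D.PiHat} (hk : k ∈ D.ellKerHat) :
    ∃ n ∈ (D.deltaY.map D.toHat.toMonoidHom).topologicalClosure, ∃ k₃ ∈ D.doubleCommutator,
      k = ⁅D.toHat.toMonoidHom σ, n⁆ * k₃ := by
  haveI : CompactSpace D.PiHat := D.isProfiniteCompletion_toHat.compactSpace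
  haveI : T2Space D.PiHat := D.isProfiniteCompletion_toHat.t2Space
  have hAA : ⁅D.deltaHat, D.deltaHat⁆ ≤ D.ellKerHat := Subgroup.le_topologicalClosure _
  have hK₂A : D.ellKerHat ≤ D.deltaHat := D.ellKerHat_le_deltaHat
  have hAK : ⁅D.deltaHat, D.ellKerHat⁆ ≤ D.doubleCommutator :=
    ThetaQuotientFacts.commutator_deltaHat_ellKerHat_le D
  have hK₃closed : IsClosed ((D.doubleCommutator : Subgroup D.PiHat) : Set D.PiHat) :=
    Subgroup.isClosed_topologicalClosure _
  have hNclosed : IsClosed (((D.deltaY.map D.toHat.toMonoidHom).topologicalClosure : Subgroup D.PiHat) :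
      Set D.PiHat) :=
    Subgroup.isClosed_topologicalClosure _
  -- `T = ι Δ^tp_X` is dense in `Δ_X` and contained in `(ι σ)^ℤ · N`
  have hAT : (D.deltaHat : Set D.PiHat) ⊆ closure ((D.delta.map D.toHat.toMonoidHom : Subgroup D.PiHat) :
      Set D.PiHat) := by
    change (((D.delta.map D.toHat.toMonoidHom).topologicalClosure : Subgroup D.PiHat) : Set D.PiHat) ⊆ _
    rw [Subgroup.topologicalClosure_coe]
  have hT : ∀ t ∈ D.delta.map D.toHat.toMonoidHom,
      ∃ i : ℤ, ∃ n ∈ (D.deltaY.map D.toHat.toMonoidHom).topologicalClosure, t = D.toHat.toMonoidHom σ ^ i * n := by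
    rintro _ ⟨t, ht, rfl⟩
    obtain ⟨i, u, hu, rfl⟩ := exists_eq_zpow_mul_of_mem_delta D hσ hσZ ht
    exact ⟨i, D.toHat.toMonoidHom u, Subgroup.le_topologicalClosure _ (Subgroup.mem_map_of_mem _ hu),
      by rw [map_mul, map_zpow]⟩
  exact exists_commutator_mul_of_mem_closure D.deltaHat D.ellKerHat D.doubleCommutator hAA hK₂A hAK
    hK₃closed (toHat_mem_deltaHat D hσ) _ (closureDeltaY_le_deltaHat D) hNclosed
    (commutator_closureDeltaY_le_doubleCommutator D) (D.delta.map D.toHat.toMonoidHom) hAT hT k hk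

/-- **`K₂ = [Δ_X,Δ_X]⁻ ≤ N = (ι Δ^tp_Y)⁻`**: `Δ_X` is the closure of `ι Δ^tp_X`, so
`[Δ_X,Δ_X] ≤ (ι [Δ^tp_X,Δ^tp_X])⁻`, and `[Δ^tp_X,Δ^tp_X] ≤ Δ^tp_Y = Δ^tp_X ∩ Ker(zQuot)` because `Z` is
abelian ([EtTh] p. 12: `Ẑ(1) ⊆ Δ^ell_X` contains nothing of the `Ẑ`-quotient). [cite: MochizukiEtTh2009, §1 p.12] -/
theorem ellKerHat_le_closureDeltaY : D.ellKerHat ≤ (D.deltaY.map D.toHat.toMonoidHom).topologicalClosure := by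
  have hNclosed : IsClosed (((D.deltaY.map D.toHat.toMonoidHom).topologicalClosure : Subgroup D.PiHat) :
      Set D.PiHat) :=
    Subgroup.isClosed_topologicalClosure _
  -- `[ι Δ^tp_X, ι Δ^tp_X] ≤ ι Δ^tp_Y`
  have h0 : ⁅D.delta.map D.toHat.toMonoidHom, D.delta.map D.toHat.toMonoidHom⁆ ≤
      D.deltaY.map D.toHat.toMonoidHom := by
    refine Subgroup.commutator_le.mpr ?_
    rintro _ ⟨s, hs, rfl⟩ _ ⟨t, ht, rfl⟩
    rw [← map_commutatorElement]
    refine Subgroup.mem_map_of_mem _ (Subgroup.mem_inf.mpr ⟨?_, ?_⟩)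
    · rw [commutatorElement_def]
      exact D.delta.mul_mem (D.delta.mul_mem (D.delta.mul_mem hs ht) (D.delta.inv_mem hs)) (D.delta.inv_mem ht)
    · change (⁅s, t⁆ : D.Pi) ∈ D.zQuot.ker
      exact Abelianization.commutator_subset_ker D.zQuot
        (Subgroup.commutator_mem_commutator (Subgroup.mem_top s) (Subgroup.mem_top t))
  -- `[Δ_X, Δ_X] ≤ ([ι Δ^tp_X, ι Δ^tp_X])⁻ ≤ N`
  have h1 : ⁅D.deltaHat, D.delta.map D.toHat.toMonoidHom⁆ ≤
      (D.deltaY.map D.toHat.toMonoidHom).topologicalClosure := by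
    change ⁅(D.delta.map D.toHat.toMonoidHom).topologicalClosure, D.delta.map D.toHat.toMonoidHom⁆ ≤ _
    exact (commutator_topologicalClosure_left_le _ _).trans
      (Subgroup.topologicalClosure_minimal _ (h0.trans (Subgroup.le_topologicalClosure _)) hNclosed)
  have h2 : ⁅D.deltaHat, D.deltaHat⁆ ≤ (D.deltaY.map D.toHat.toMonoidHom).topologicalClosure := by
    change ⁅D.deltaHat, (D.delta.map D.toHat.toMonoidHom).topologicalClosure⁆ ≤ _
    exact (commutator_topologicalClosure_right_le _ _).trans
      (Subgroup.topologicalClosure_minimal _ h1 hNclosed)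
  exact Subgroup.topologicalClosure_minimal _ h2 hNclosed

end OncePuncturedCyclotomic

end Literature.AnabelianGeometry.EtaleTheta

end
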